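import Summits.ABC.ABC.Theorems.CongruentialReceptacleTameLocalReceptacleDefs

/-!
# Sketch (crux-ideate r2, ideator 4) — SHIFT RIGIDITY + PARITY TRANSPORT
for crux `TameLocalReceptacle` (stmt-ABC-14354).

Lever: on the two-dimensional box of κ-balanced triples, two triples sharing a member give the
shift relation `(A a − A (a−h)) − (B (y+h) − B y) = O(c₃)` (`shift_relation`); telescoping it over
`m ≍ log X` consecutive shifts against the trivial bound `|B| ≪ c₁' log X` (`telescoping_rigidity`)
makes every position sum LOCALLY RIGID: constant up to `O(c₁'+c₃)` on each parity class inside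
windows of length `X / log X`.  Around the dyadic point `(2^N, 2^N, 2^{N+1})` the three parity
patterns `(e,o,o), (o,e,o), (o,o,e)` of a triple then give three linear relations among six local
constants; with the three income keys `t(2;N,0,0;1,1,1), t(2;0,N,0;1,1,1), t(2;0,0,N+1;1,1,1)`
(`≥ c₁(2N−6−ε) log 2` each) they FORCE a parity offset `A(even) − A(odd) = D ≥ 3c₁ log X − O(1)` in
every position.  Parity transport kills `D`: the product families `{u v w}` (odd) and `{2 u′ v′ w′}`
(even) in the same window have the same key law up to the bijection `s ↦ 2s` of unit residues
(products of two intervals are equidistributed modulo the third factor's primes — elementary), so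
`D = t(2;1,0,0;1,1,1) + O(1) = O(c₁')`.  Contradiction for `N` large.  No friable numbers, no circle
method, no Chebyshev/Mertens; the only counting is of lattice points in progressions.

What it proves unconditionally: no PARTNER-BOUNDED table (dependence on the two partner residues
bounded by `K`; dependence on the member's OWN unit residue ARBITRARY) witnesses the crux — a class
containing residue-free (p101231) and near-residue-free (p116469) tables and incomparable with the
Kummer-local / quadratic-local classes (p118459 / p118031).  Hence (`_false_without_` shape): any
witness of `TameLocalReceptacle` draws its whole slope from the partner-interaction cocycle.
-/

set_option linter.dupNamespace false

namespace Summit.ABC.ABC.Cruxes.TameLocalReceptacle.ShiftRigidity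

open Finset Literature.NumberTheory.DiophantineGeometry
open Summit.ABC.ABC.Theses.CongruentialReceptacle
open Summit.ABC.ABC.Theorems.TameLocalReceptacle

/-- `K`-PARTNER-BOUNDED table: at a prime of the A-member (`0 < i`) the entry depends on the partner
residues `(s, z)` only up to `K`; likewise at primes of the B-member (own residue `s`) and of the
C-member (own residue `z`).  Dependence on `p`, the exponents and the member's OWN unit residue is free. -/
def PartnerBounded (K : ℝ) (t : Table) : Prop :=
  ∀ p i j k r s z r' s' z' : ℕ, p.Prime →
    ((0 < i ∧ r = r') ∨ (0 < j ∧ s = s') ∨ (0 < k ∧ z = z')) →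
    |(t p i j k r s z : ℝ) - (t p i j k r' s' z' : ℝ)| ≤ K

/-- The PARTNER-BOUNDED sub-class of the crux (same quantifier shape as `TameLocalReceptacle`, one more
existential constant `K`, one more conjunct `PartnerBounded K t`). -/
def TameLocalReceptaclePartnerBounded : Prop :=
  ∀ κ : ℝ, 0 < κ → ∀ ε : ℝ, 0 < ε → ∃ c₁ c₁' c₃ K : ℝ, 0 < c₁ ∧ ∃ m₀ : ℕ, ∀ ℓ n : ℕ, ℓ.Prime → 5 ≤ ℓ →
    m₀ ≤ ℓ ^ n → ∃ t : Table, PartnerBounded K t ∧ InWindow ε c₁ c₁' t ∧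
      ∀ a b c : ℕ, IsABCTriple a b c → κ * (c : ℝ) ≤ (a : ℝ) → κ * (c : ℝ) ≤ (b : ℝ) → ¬ ℓ ∣ a * b * c →
        ∃ B : ℤ, |(B : ℝ)| ≤ c₃ ∧ recSum t a b c ≡ B [ZMOD ((ℓ ^ n : ℕ) : ℤ)]

/-- FIRST LEMMA of the line (pure algebra, PROVED): the telescoping step of shift rigidity.  If one fixed
quantity `Δ` (an A-difference `A F − A (F−h)`) equals, up to `δ`, each of `m` CONSECUTIVE `h`-differences
of a function `B` along `y, y+h, …, y+mh`, and `B` is bounded by `L` on that chain, then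
`m · |Δ| ≤ 2L + m δ` — so `|Δ| ≤ 2L/m + δ = O(1)` for `m ≍ log X ≍ L`. -/
theorem telescoping_rigidity (B : ℕ → ℝ) (Δ δ L : ℝ) (y h m : ℕ)
    (hstep : ∀ i < m, |Δ - (B (y + (i + 1) * h) - B (y + i * h))| ≤ δ)
    (hL : ∀ i ≤ m, |B (y + i * h)| ≤ L) :
    (m : ℝ) * |Δ| ≤ 2 * L + m * δ := by
  -- `m Δ = Σ_{i<m} (Δ − dᵢ) + (B(y+mh) − B y)` with `dᵢ` the consecutive differences.
  have htel : ∀ n : ℕ, n ≤ m →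
      (n : ℝ) * Δ = (∑ i ∈ range n, (Δ - (B (y + (i + 1) * h) - B (y + i * h))))
        + (B (y + n * h) - B (y + 0 * h)) := by
    intro n hn
    induction n with
    | zero => simp
    | succ n ih =>
      have := ih (Nat.le_of_succ_le hn)
      rw [sum_range_succ]
      push_cast
      linarith
  have hm := htel m le_rfl
  have hsum : |∑ i ∈ range m, (Δ - (B (y + (i + 1) * h) - B (y + i * h)))| ≤ m * δ := by
    calc |∑ i ∈ range m, (Δ - (B (y + (i + 1) * h) - B (y + i * h)))|
        ≤ ∑ i ∈ range m, |Δ - (B (y + (i + 1) * h) - B (y + i * h))| := abs_sum_le_sum_abs _ _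
      _ ≤ ∑ _i ∈ range m, δ := sum_le_sum fun i hi => hstep i (mem_range.mp hi)
      _ = m * δ := by simp
  have h0 := hL 0 (Nat.zero_le _)
  have h1 := hL m le_rfl
  have habs : |(m : ℝ) * Δ| ≤ m * δ + (L + L) := by
    rw [hm]
    calc |(∑ i ∈ range m, (Δ - (B (y + (i + 1) * h) - B (y + i * h)))) + (B (y + m * h) - B (y + 0 * h))|
        ≤ |∑ i ∈ range m, (Δ - (B (y + (i + 1) * h) - B (y + i * h)))| + |B (y + m * h) - B (y + 0 * h)| :=
          abs_add_le _ _
      _ ≤ m * δ + (L + L) := by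
          gcongr
          calc |B (y + m * h) - B (y + 0 * h)| ≤ |B (y + m * h)| + |B (y + 0 * h)| := abs_sub _ _
            _ ≤ L + L := add_le_add h1 h0
  rw [abs_mul, Nat.abs_cast] at habs
  linarith

/-- SHIFT RELATION (PROVED, pure algebra): two admissible pairs `(a, y)` and `(a − h, y + h)` share the
C-member, so for a partner-FREE decomposition `Φ(a,b) = A a + B b + C (a+b)` bounded by `c₃` the
A-difference at shift `h` equals the B-difference at shift `h` up to `2 c₃`. -/
theorem shift_relation (A B C : ℕ → ℝ) (c₃ : ℝ) {a y h : ℕ} (hh : h ≤ a)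
    (h₁ : |A a + B y + C (a + y)| ≤ c₃) (h₂ : |A (a - h) + B (y + h) + C (a - h + (y + h))| ≤ c₃) :
    |(A a - A (a - h)) - (B (y + h) - B y)| ≤ 2 * c₃ := by
  have : a - h + (y + h) = a + y := by omega
  rw [this] at h₂
  have := abs_sub _ _ |>.trans (add_le_add h₁ h₂) -- |X − Y| ≤ |X| + |Y|
  have key : (A a - A (a - h)) - (B (y + h) - B y)
      = (A a + B y + C (a + y)) - (A (a - h) + B (y + h) + C (a + y)) := by ring
  rw [key]; linarith [abs_sub (A a + B y + C (a + y)) (A (a - h) + B (y + h) + C (a + y))]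

/-- PEXIDER ALGEBRA at the dyadic point (PROVED): the three parity patterns of a triple give three
bounded relations among the six local constants (`α` = A-position, `β` = B, `γ` = C; `o`/`e` = odd/even
member); the three dyadic income keys give `αe, βe, γe ≥ 2L` (`L ≈ c₁ N log 2`).  Then the parity offset
`αe − αo` is forced `≥ 3L − 3c`, and the three positions' offsets agree up to `2c`. -/
theorem parity_offset_forced (αo αe βo βe γo γe L c : ℝ)
    (E1 : |αe + βo + γo| ≤ c) (E2 : |αo + βe + γo| ≤ c) (E3 : |αo + βo + γe| ≤ c)
    (hA : 2 * L ≤ αe) (hB : 2 * L ≤ βe) (hC : 2 * L ≤ γe) :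
    3 * L - 3 * c ≤ αe - αo ∧ |(αe - αo) - (βe - βo)| ≤ 2 * c ∧ |(βe - βo) - (γe - γo)| ≤ 2 * c := by
  rw [abs_le] at E1 E2 E3
  obtain ⟨E1l, E1u⟩ := E1
  obtain ⟨E2l, E2u⟩ := E2
  obtain ⟨E3l, E3u⟩ := E3
  refine ⟨by linarith, ?_, ?_⟩ <;> rw [abs_le] <;> constructor <;> linarith

/-- TARGET of the line (the unconditional negative theorem; elementary, est. 700–1000 Lean lines):
no partner-bounded table witnesses the crux.  Proof plan (idea card `shift-rigidity-pexider`):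
(1) one table per finite configuration (`ℓ` prime above every member in play, `n` large,
`CongruenceToEquality`); (2) `Φ = A(a) + B(b) + C(c) + O(K·ω)` by `PartnerBounded`;
(3) LOCAL RIGIDITY on each parity class (odd parts free of odd primes `≤ ½ log X`) in windows of length
`X / log X`: `shift_relation` + `telescoping_rigidity` with `m ≍ log X`, chain partners by CRT, chain
start by counting; (4) Pexider algebra at the dyadic point: parity offset `D ≥ 3c₁ log X − O(1)`;
(5) PARITY TRANSPORT: `D = t(2;1,0,0;1,1,1) + O(1)` by comparing the key laws of `{uvw}` and `{2u′v′w′}`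
(equidistribution of products of two intervals modulo a prime: elementary exponential sum / divisor bound). -/
theorem not_tameLocalReceptaclePartnerBounded : ¬ TameLocalReceptaclePartnerBounded := by
  sorry

/-- `_false_without_` shape for `Disproof.lean`: a crux witness whose tables are all `K`-partner-bounded
for one `K` would prove the partner-bounded sub-class; so every witness of the crux has UNBOUNDED
partner interaction (the slope `2 log X` of the dyadic specials is carried entirely by the interaction
cocycle `d = t − (partner mean of t)`). -/
theorem TameLocalReceptacle_false_without_unboundedInteraction
    (h : TameLocalReceptaclePartnerBounded) : False :=
  not_tameLocalReceptaclePartnerBounded h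

end Summit.ABC.ABC.Cruxes.TameLocalReceptacle.ShiftRigidity
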